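import Literature.LinearAlgebra.PosDefHermitianFormOrthonormalBasis
import HarnessLib

/-!
# The orthogonal projector of a sesquilinear form onto a finite-dimensional orthonormalised subspace

Topic `Literature/LinearAlgebra` (namespace `Literature.LinearAlgebra`); Mathlib-only (+ ★
`Literature.LinearAlgebra.PosDefHermitianFormOrthonormalBasis`); THEOREMS ONLY — no definition, no instance, no notation,
no named fact.

SETTING.  `V` an ARBITRARY complex vector space (no topology, no finiteness, no inner-product instance),
`B : V →ₗ⋆[ℂ] V →ₗ[ℂ] ℂ` a sesquilinear form (conjugate-linear in the first variable — the currency of ★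
`Representation.IsUnitarizable`), `W : Submodule ℂ V` a submodule with a `B`-ORTHONORMAL basis `b : Basis ι ℂ W`
(`B (b i) (b j) = if i = j then 1 else 0`, `ι` finite; such a basis exists when `B` is Hermitian and positive definite on a
finite-dimensional `W`: ★ `exists_basis_orthonormal_submodule`).  The file studies the EXPLICIT expression

  `P v := ∑ i, B (b i) v • (b i : V)`       (no `def` is introduced: every statement is about this sum)

— the `B`-orthogonal projection of `V` onto `W`.

RESULTS (most need orthonormality ONLY — no symmetry, no positivity on `V`).
* §1 `sum_apply_smul_mem` (`P v ∈ W`), `apply_basis_sub_sum_eq_zero` (`B (b j) (v - P v) = 0`),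
  `apply_sub_sum_eq_zero_of_mem` (`B w (v - P v) = 0` for every `w ∈ W`), `sum_apply_smul_idem` (`P (P v) = P v`),
  `sum_apply_smul_eq_zero_of_orthogonal` (`P v = 0` when `v ⊥_B W`); `P w = w` on `W` is ★ `sum_apply_smul_eq_of_mem`.
* §2 UNIQUENESS ∕ RECOGNITION (the consumer's lemma): `eq_sum_apply_smul_of_mem_of_apply_basis_sub_eq_zero` — if `u ∈ W`
  and `B (b j) (v - u) = 0` for all `j` then `u = P v`; `eq_sum_apply_smul_of_mem_of_orthogonal` (hypothesis
  `∀ w ∈ W, B w (v - u) = 0`); the FUNCTION form `forall_eq_sum_apply_smul_of_mem_of_orthogonal` — ANY map `Q : V → V`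
  with `Q v ∈ W` and `v - Q v ⊥_B W` IS `P` (e.g. the averaging operator `e_K = ∫_K π(k) dk` of a representation with a
  `π`-invariant `B`, on `W = V^K`); and BASIS-INDEPENDENCE `sum_apply_smul_eq_sum_apply_smul` (two `B`-orthonormal bases
  of `W` give the same `P`).
* §3 THE LINEAR MAP: `exists_linearMap_projector` — `∃ P : V →ₗ[ℂ] V` with `P v = ∑ i, B (b i) v • b i`, `P v ∈ W`,
  `P w = w` on `W`, `P ∘ₗ P = P`, `range P = W`, `v - P v ⊥_B W`.
* §4 MATRIX COEFFICIENTS of `P` (sesquilinearity only): `apply_sum_apply_smul_left` (`B (P v) u = ∑ i, conj (B (b i) v) *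
  B (b i) u`), `apply_sum_apply_smul_right` (`B u (P v) = ∑ i, B (b i) v * B u (b i)`), `apply_sum_sum`
  (`B (P v) (P u) = ∑ i, conj (B (b i) v) * B (b i) u = B (P v) u`); with `B` HERMITIAN (`B.IsSymm`):
  `apply_sum_apply_smul_comm` (`B (P v) u = B v (P u)`, self-adjointness), `apply_self_eq_add` (Pythagoras
  `B v v = B (P v) (P v) + B (v - P v) (v - P v)`), and with `B` POSITIVE SEMIDEFINITE on `V`: `sum_normSq_apply_le`
  (BESSEL `∑ i, |B (b i) v|² ≤ re (B v v)`).

WHY (consumer-in-waiting).  Census HC-SC §2 E2-2 (T2) (cell `hodgecm-mathlib`): «expand `π(x) v` on the `B`-orthonormal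
basis `(e_i)` of `V^{K′}` INSIDE `π(φ)`»: `π(φ) π(x) v = π(φ) e_{K′} π(x) v` and `e_{K′} u = Σ_i B(e_i, u) e_i` — the second
equality is §2's recognition lemma applied to `Q = e_{K′}` (its two hypotheses are «`e_{K′} u` is `K′`-fixed» and
«`B(w, u - e_{K′} u) = 0` for `K′`-fixed `w`», i.e. invariance of `B`), with no inner-product structure on the
infinite-dimensional `V`.

NEAREST PRIOR ART (searched; cited, not restated).  Mathlib `orthogonalProjection` ∕ `Submodule.starProjection`
(`Mathlib/Analysis/InnerProductSpace/Projection*`) require a REGISTERED `InnerProductSpace` on the ambient space and a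
complete `K`; here `V` carries no norm and `B` need not be definite (or even Hermitian) on `V` — only orthonormalised on
`W`.  ★ `Literature.LinearAlgebra.PosDefHermitianFormOrthonormalBasis` supplies the basis and the expansion on `W`.

References (one `[cite:]` token per line — ED. 2 joins the line-broken header token of ED. 1; no declaration changed).
[cite: HornJohnson2013, §0.6.4–0.6.5 (orthonormal sets, Gram–Schmidt, orthogonal projection onto the span of an orthonormal list, Bessel's inequality)]
[cite: HornJohnson2013, §4.1 (Hermitian forms)]
-/

noncomputable section

open _root_.Module

open scoped _root_.BigOperators _root_.ComplexConjugate

namespace Literature.LinearAlgebra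

variable {V : Type*} [AddCommGroup V] [Module ℂ V]
variable {ι : Type*} [Fintype ι] [DecidableEq ι]
variable (B : V →ₗ⋆[ℂ] V →ₗ[ℂ] ℂ) (W : Submodule ℂ V) (b : Basis ι ℂ W)
  (hb : ∀ i j, B (b i) (b j) = if i = j then 1 else 0)

/-! ## §1 The projection `v ↦ ∑ i, B (b i) v • b i`: range, orthogonality of the residual, idempotence -/

omit [DecidableEq ι] in
/-- `∑ i, B (b i) v • b i` lies in `W`. [cite: HornJohnson2013, §0.6.4–0.6.5] -/
theorem sum_apply_smul_mem (v : V) : ∑ i, B (b i) v • (b i : V) ∈ W :=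
  Submodule.sum_mem W fun i _ => Submodule.smul_mem W _ (b i).2

include hb

/-- **The residual is `B`-orthogonal to the basis**: `B (b j) (v - ∑ i, B (b i) v • b i) = 0`.
[cite: HornJohnson2013, §0.6.4–0.6.5] -/
theorem apply_basis_sub_sum_eq_zero (v : V) (j : ι) : B (b j) (v - ∑ i, B (b i) v • (b i : V)) = 0 := by
  simp only [map_sub, map_sum, map_smul, smul_eq_mul, hb, mul_ite, mul_one, mul_zero, Finset.sum_ite_eq,
    Finset.mem_univ, if_true, sub_self]

/-- **The residual is `B`-orthogonal to `W`**: `B w (v - ∑ i, B (b i) v • b i) = 0` for every `w ∈ W`.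
[cite: HornJohnson2013, §0.6.4–0.6.5] -/
theorem apply_sub_sum_eq_zero_of_mem (v w : V) (hw : w ∈ W) : B w (v - ∑ i, B (b i) v • (b i : V)) = 0 := by
  conv_lhs => rw [← sum_apply_smul_eq_of_mem B W b hb w hw]
  simp only [map_sum, LinearMap.map_smulₛₗ, LinearMap.sum_apply, LinearMap.smul_apply,
    apply_basis_sub_sum_eq_zero B W b hb v, smul_zero, Finset.sum_const_zero]

/-- **Idempotence**: `P (P v) = P v`. [cite: HornJohnson2013, §0.6.4–0.6.5] -/
theorem sum_apply_smul_idem (v : V) :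
    ∑ i, B (b i) (∑ j, B (b j) v • (b j : V)) • (b i : V) = ∑ j, B (b j) v • (b j : V) :=
  sum_apply_smul_eq_of_mem B W b hb _ (sum_apply_smul_mem B W b v)

omit [DecidableEq ι] hb in
/-- **`P v = 0` when `v` is `B`-orthogonal to the basis.** [cite: HornJohnson2013, §0.6.4–0.6.5] -/
theorem sum_apply_smul_eq_zero_of_orthogonal (v : V) (hv : ∀ j, B (b j) v = 0) :
    ∑ i, B (b i) v • (b i : V) = 0 := by
  simp only [hv, zero_smul, Finset.sum_const_zero]

/-! ## §2 Uniqueness ∕ recognition and basis-independence -/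

/-- **Recognition of the projection (basis form).**  If `u ∈ W` and `B (b j) (v - u) = 0` for every `j`, then
`u = ∑ i, B (b i) v • b i`.  (Only orthonormality of `b` is used: `B|_W` is automatically non-degenerate.)
[cite: HornJohnson2013, §0.6.4–0.6.5] -/
theorem eq_sum_apply_smul_of_mem_of_apply_basis_sub_eq_zero {v u : V} (hu : u ∈ W) (horth : ∀ j, B (b j) (v - u) = 0) :
    u = ∑ i, B (b i) v • (b i : V) := by
  conv_lhs => rw [← sum_apply_smul_eq_of_mem B W b hb u hu]
  refine Finset.sum_congr rfl fun i _ => ?_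
  have h := horth i
  rw [map_sub, sub_eq_zero] at h
  rw [h]

/-- **Recognition of the projection.**  If `u ∈ W` and `v - u` is `B`-orthogonal to `W`, then `u = ∑ i, B (b i) v • b i`.
[cite: HornJohnson2013, §0.6.4–0.6.5] -/
theorem eq_sum_apply_smul_of_mem_of_orthogonal {v u : V} (hu : u ∈ W) (horth : ∀ w ∈ W, B w (v - u) = 0) :
    u = ∑ i, B (b i) v • (b i : V) :=
  eq_sum_apply_smul_of_mem_of_apply_basis_sub_eq_zero B W b hb hu fun j => horth _ (b j).2

/-- **Recognition, function form (the consumer's lemma).**  ANY map `Q : V → V` (no linearity assumed) with values in `W`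
and `B`-orthogonal residuals — e.g. the averaging operator `e_K v = ∫_K π(k) v dk` of a representation `π` leaving `B`
invariant, on `W = V^K` — is the orthonormal expansion: `Q v = ∑ i, B (b i) v • b i` for all `v`.
[cite: HornJohnson2013, §0.6.4–0.6.5] -/
theorem forall_eq_sum_apply_smul_of_mem_of_orthogonal (Q : V → V) (hQmem : ∀ v, Q v ∈ W)
    (hQorth : ∀ v, ∀ w ∈ W, B w (v - Q v) = 0) (v : V) : Q v = ∑ i, B (b i) v • (b i : V) :=
  eq_sum_apply_smul_of_mem_of_orthogonal B W b hb (hQmem v) (hQorth v)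

/-- **Basis-independence**: two `B`-orthonormal bases `b`, `b'` of `W` (possibly with different index types) define the
same projection. [cite: HornJohnson2013, §0.6.4–0.6.5] -/
theorem sum_apply_smul_eq_sum_apply_smul {ι' : Type*} [Fintype ι'] [DecidableEq ι'] (b' : Basis ι' ℂ W)
    (hb' : ∀ i j, B (b' i) (b' j) = if i = j then 1 else 0) (v : V) :
    ∑ i, B (b i) v • (b i : V) = ∑ i, B (b' i) v • (b' i : V) :=
  eq_sum_apply_smul_of_mem_of_orthogonal B W b' hb' (sum_apply_smul_mem B W b v)
    (fun w hw => apply_sub_sum_eq_zero_of_mem B W b hb v w hw)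

/-! ## §3 The projection as a linear map -/

/-- **The `B`-orthogonal projector onto `W` as a linear endomorphism of `V`** (existence without a `def`): there is
`P : V →ₗ[ℂ] V` with `P v = ∑ i, B (b i) v • b i`, values in `W`, identity on `W`, idempotent, of range `W`, and with
`B`-orthogonal residuals. [cite: HornJohnson2013, §0.6.4–0.6.5] -/
theorem exists_linearMap_projector :
    ∃ P : V →ₗ[ℂ] V, (∀ v, P v = ∑ i, B (b i) v • (b i : V)) ∧ (∀ v, P v ∈ W) ∧ (∀ w ∈ W, P w = w) ∧
      P ∘ₗ P = P ∧ LinearMap.range P = W ∧ ∀ v, ∀ w ∈ W, B w (v - P v) = 0 := by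
  let P : V →ₗ[ℂ] V := ∑ i, (LinearMap.toSpanSingleton ℂ V (b i : V)) ∘ₗ (B (b i) : V →ₗ[ℂ] ℂ)
  have hP : ∀ v, P v = ∑ i, B (b i) v • (b i : V) := fun v => by
    simp only [P, LinearMap.sum_apply, LinearMap.comp_apply, LinearMap.toSpanSingleton_apply]
  refine ⟨P, hP, fun v => ?_, fun w hw => ?_, ?_, ?_, fun v w hw => ?_⟩
  · rw [hP]; exact sum_apply_smul_mem B W b v
  · rw [hP]; exact sum_apply_smul_eq_of_mem B W b hb w hw
  · ext v
    rw [LinearMap.comp_apply, hP (P v), hP v]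
    exact sum_apply_smul_idem B W b hb v
  · refine le_antisymm ?_ fun w hw => ⟨w, ?_⟩
    · rintro _ ⟨v, rfl⟩
      rw [hP]; exact sum_apply_smul_mem B W b v
    · rw [hP]; exact sum_apply_smul_eq_of_mem B W b hb w hw
  · rw [hP]; exact apply_sub_sum_eq_zero_of_mem B W b hb v w hw

/-! ## §4 Matrix coefficients of the projection; self-adjointness, Pythagoras, Bessel -/

omit [DecidableEq ι] hb in
/-- `B (P v) u = ∑ i, conj (B (b i) v) * B (b i) u` (sesquilinearity only). [cite: HornJohnson2013, §0.6.4–0.6.5] -/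
theorem apply_sum_apply_smul_left (v u : V) :
    B (∑ i, B (b i) v • (b i : V)) u = ∑ i, conj (B (b i) v) * B (b i) u := by
  simp only [map_sum, LinearMap.map_smulₛₗ, LinearMap.sum_apply, LinearMap.smul_apply, smul_eq_mul,
    starRingEnd_apply]

omit [DecidableEq ι] hb in
/-- `B u (P v) = ∑ i, B (b i) v * B u (b i)` (linearity in the second slot only). [cite: HornJohnson2013, §0.6.4–0.6.5] -/
theorem apply_sum_apply_smul_right (v u : V) :
    B u (∑ i, B (b i) v • (b i : V)) = ∑ i, B (b i) v * B u (b i) := by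
  simp only [map_sum, map_smul, smul_eq_mul]

/-- `B (P v) (P u) = ∑ i, conj (B (b i) v) * B (b i) u` (orthonormality). [cite: HornJohnson2013, §0.6.4–0.6.5] -/
theorem apply_sum_sum (v u : V) :
    B (∑ i, B (b i) v • (b i : V)) (∑ i, B (b i) u • (b i : V)) = ∑ i, conj (B (b i) v) * B (b i) u := by
  rw [apply_sum_apply_smul_left B W b]
  refine Finset.sum_congr rfl fun i _ => ?_
  congr 1
  have h := apply_basis_sub_sum_eq_zero B W b hb u i
  rw [map_sub, sub_eq_zero] at h
  exact h.symm

/-- `B (P v) (P u) = B (P v) u`. [cite: HornJohnson2013, §0.6.4–0.6.5] -/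
theorem apply_sum_sum_eq_apply_sum_left (v u : V) :
    B (∑ i, B (b i) v • (b i : V)) (∑ i, B (b i) u • (b i : V)) = B (∑ i, B (b i) v • (b i : V)) u := by
  rw [apply_sum_sum B W b hb, apply_sum_apply_smul_left B W b]

/-- `B (P v) (P v) = ∑ i, |B (b i) v|²` (as a complex number). [cite: HornJohnson2013, §0.6.4–0.6.5] -/
theorem apply_sum_sum_self (v : V) :
    B (∑ i, B (b i) v • (b i : V)) (∑ i, B (b i) v • (b i : V)) = ∑ i, (Complex.normSq (B (b i) v) : ℂ) := by
  rw [apply_sum_sum B W b hb]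
  refine Finset.sum_congr rfl fun i _ => ?_
  rw [Complex.normSq_eq_conj_mul_self]

omit [DecidableEq ι] hb in
/-- **Self-adjointness** for a HERMITIAN `B`: `B (P v) u = B v (P u)`. [cite: HornJohnson2013, §4.1 and §0.6.4–0.6.5] -/
theorem apply_sum_apply_smul_comm (hBsymm : B.IsSymm) (v u : V) :
    B (∑ i, B (b i) v • (b i : V)) u = B v (∑ i, B (b i) u • (b i : V)) := by
  rw [apply_sum_apply_smul_left B W b, apply_sum_apply_smul_right B W b]
  refine Finset.sum_congr rfl fun i _ => ?_
  rw [← hBsymm.eq (b i : V) v, starRingEnd_apply, mul_comm]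

/-- **Pythagoras** for a HERMITIAN `B`: `B v v = B (P v) (P v) + B (v - P v) (v - P v)`.
[cite: HornJohnson2013, §0.6.4–0.6.5] -/
theorem apply_self_eq_add (hBsymm : B.IsSymm) (v : V) :
    B v v = B (∑ i, B (b i) v • (b i : V)) (∑ i, B (b i) v • (b i : V)) +
      B (v - ∑ i, B (b i) v • (b i : V)) (v - ∑ i, B (b i) v • (b i : V)) := by
  set p := ∑ i, B (b i) v • (b i : V) with hp
  have h1 : B p (v - p) = 0 := apply_sub_sum_eq_zero_of_mem B W b hb v p (sum_apply_smul_mem B W b v)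
  have h2 : B (v - p) p = 0 := by
    rw [← hBsymm.eq p (v - p), h1, map_zero]
  have h3 : B v v = B (p + (v - p)) (p + (v - p)) := by rw [add_sub_cancel]
  rw [h3, B.map_add p (v - p), LinearMap.add_apply, (B p).map_add, (B (v - p)).map_add, h1, h2, add_zero,
    zero_add]

/-- **Bessel's inequality** for a Hermitian form that is positive SEMIdefinite on `V`:
`∑ i, |B (b i) v|² ≤ re (B v v)`. [cite: HornJohnson2013, §0.6.4–0.6.5 (Bessel's inequality)] -/
theorem sum_normSq_apply_le (hBsymm : B.IsSymm) (hBnonneg : ∀ v : V, 0 ≤ (B v v).re) (v : V) :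
    ∑ i, Complex.normSq (B (b i) v) ≤ (B v v).re := by
  have h := congr_arg Complex.re (apply_self_eq_add B W b hb hBsymm v)
  rw [Complex.add_re, apply_sum_sum_self B W b hb] at h
  have hre : (∑ i, (Complex.normSq (B (b i) v) : ℂ)).re = ∑ i, Complex.normSq (B (b i) v) := by
    rw [← Complex.ofReal_sum, Complex.ofReal_re]
  rw [hre] at h
  rw [h]
  exact le_add_of_nonneg_right (hBnonneg _)

end Literature.LinearAlgebra

end
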